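import Summits.ABC.ABC.Theorems.DefiniteXiFreyModularityIsModular
import Literature.NumberTheory.Automorphic.BCDTTheoremB
import Literature.NumberTheory.Automorphic.CDTTheorem712
import Literature.NumberTheory.Automorphic.CDTTheorem722
import Literature.NumberTheory.Automorphic.LanglandsTunnellModThree
import Literature.NumberTheory.Automorphic.StrongArtinGL2
import Literature.NumberTheory.Automorphic.PiOfArtinRepFrobSatakeCompatibleProofs
import Literature.NumberTheory.GaloisRepresentations.ProjectiveType
import HarnessLib

/-!
# STUB-IDEAS `stub_modThree` · ideator k1 (FAMILY 1 — recognise & import) · GENERATION 9 — companion (variant b)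

Crux `FreyModularity` (stmt-ABC-11340), registered line `Lines/Sketch.lean` (sha 21576c53…), stub S1a
`stub_modThree` (l. 143).  Gen 9 delta over the gen-8 companion (`STUB_IDEAS_stub_modThree_1_g8.lean`):

* the switch road of PLAN F″ is the landed `Summit.ABC.ABC.Theorems.isModular_freyCurve_of_lifts`
  (`Theorems/DefiniteXiFreyModularitySketch.lean`) with case A deleted and `hlift9` weakened to
  SURJECTIVE `ρ̄₃`.  VARIANT (b): the farm snapshot of 2026-08-31 does not build the module chain
  `…DefiniteXiFreyModularitySketch → …StubAbsIrrSqrtFive → …StubAbsIrrSqrtFiveGroup` (lean check rc 75,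
  `remote:stale:unbuilt`), so — exactly as in gen 8 — the three LANDED Frey inputs
  `isIrreducible_freyCurve_five`, `stub_absIrrSqrtFive`, `stub_nineTransfer` enter as hypotheses
  `FreyFiveIrreducible`, `AbsIrrSqrtFive`, `NineTransfer` whose types are those theorems' types
  verbatim.  BY-NAME VERSION (checked locally only up to the farm's stale module; to be preferred as
  soon as that chain builds): replace this file's first import by
  `import Summits.ABC.ABC.Theorems.DefiniteXiFreyModularitySketchReshape3`, delete the defs
  `FreyFiveIrreducible` / `AbsIrrSqrtFive` / `NineTransfer` and the local
  `not_twentyFive_dvd_conductorNorm_freyCurve`, and in `isModular_freyCurve_of_lifts_surj` use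
  `Summit.ABC.ABC.Theorems.isIrreducible_freyCurve_five a b hab h0 ρ hρ`,
  `Summit.ABC.ABC.Theorems.stub_absIrrSqrtFive (freyCurve a b) h25 ρ hρ hirr`,
  `Summit.ABC.ABC.Theorems.stub_nineTransfer (freyCurve a b) W' ρ hρ hρ' h9` and
  `Summit.ABC.ABC.Theorems.not_twentyFive_dvd_conductorNorm_freyCurve hab h0` for `hirr`, `h5`, `h9'`,
  `h25` (the hypotheses `h4a h4b h6` then disappear from every signature below);
* the file is `sorry`-FREE: the two prover-sized helpers of PLAN T^surj (O1 octahedral type, H1 localised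
  Langlands–Tunnell descent; both PROVED in the gen-6 companion) enter as `Prop` hypotheses `SigO1`,
  `SigH1`, not as sorried theorems, so every composition below is closed modulo its named hypotheses.

Net statement (kernel-checked): `FreyModularity_of_two_facts :
  SigO1 → SigH1 → strongArtin_of_isOctahedralType → exists_isNewform1_of_isPiOfArtinRep →
  exists_isTorsionGaloisRep_five_and_surjective_three → StubLiftThree → StubLiftFive → StubThreeImpTwo →
  FreyFiveIrreducible → AbsIrrSqrtFive → NineTransfer → FreyModularity`.
Nothing here is registered; the skeleton is untouched.
-/

noncomputable section

open scoped MatrixGroups NumberField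
open NumberField IsDedekindDomain Field
open Literature.NumberTheory.EllipticCurves
open Literature.NumberTheory.EllipticCurves.ModularForms
open Literature.NumberTheory.Automorphic
open Literature.NumberTheory.Automorphic.BCDT
open Literature.NumberTheory.GaloisRepresentations
open Literature.NumberTheory.GaloisRepresentations.GL2F3Lift
open WeierstrassCurve

set_option linter.dupNamespace false

namespace Summit.ABC.ABC.Cruxes.FreyModularity.Sketch.StubModThreeIdeasK1G9b

/-! ## §0  The registered stubs as `Prop`s (VERBATIM `Lines/Sketch.lean`) and the surjective half -/

/-- S1a `stub_modThree`, verbatim. -/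
def StubModThree : Prop :=
  ∀ (W : WeierstrassCurve ℚ) [W.IsElliptic] (ρ : ModPGaloisRep ℚ (ZMod 3) 2),
    W.IsTorsionGaloisRep 3 ρ → FramedRep.IsAbsolutelyIrreducible ρ → ρ.IsModular

/-- **F5 = S1a^surj** — the only instance of S1a the Frey line consumes: Langlands–Tunnell for a framed
`ρ̄_{E,3}` ONTO `GL₂(𝔽₃)`. -/
def StubModThreeSurj : Prop :=
  ∀ (W : WeierstrassCurve ℚ) [W.IsElliptic] (ρ : ModPGaloisRep ℚ (ZMod 3) 2),
    W.IsTorsionGaloisRep 3 ρ → Function.Surjective ρ → ρ.IsModular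

/-- S1b `stub_liftThree`, verbatim. -/
def StubLiftThree : Prop :=
  ∀ (W : WeierstrassCurve ℚ) [W.IsElliptic] (ρ : ModPGaloisRep ℚ (ZMod 3) 2),
    W.IsTorsionGaloisRep 3 ρ → ρ.IsAbsIrreducibleOverSqrt (-3) → ¬ 9 ∣ W.conductorNorm ℤ →
    ρ.IsModular → W.IsModularGaloisRepTate 3

/-- S2 `stub_liftFive`, verbatim. -/
def StubLiftFive : Prop :=
  ∀ (W : WeierstrassCurve ℚ) [W.IsElliptic] (ρ : ModPGaloisRep ℚ (ZMod 5) 2),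
    W.IsTorsionGaloisRep 5 ρ → ρ.IsAbsIrreducibleOverSqrt 5 → ¬ 25 ∣ W.conductorNorm ℤ →
    ρ.IsModular → W.IsModularGaloisRepTate 5

/-- S9 `stub_threeImpTwo`, verbatim. -/
def StubThreeImpTwo : Prop :=
  ∀ (W : WeierstrassCurve ℚ) [W.IsElliptic] [NeZero (W.conductorNorm ℤ)] (ℓ : ℕ) [Fact ℓ.Prime],
    W.IsModularGaloisRepTate ℓ → BCDT.IsModular W

/-- The semistable-at-`3` lifting input of the LANDED `Summit.ABC.ABC.Theorems.freyModularity_of_lifts`,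
with `ρ̄|_{ℚ(√-3)}` absolutely irreducible WEAKENED to `ρ̄` surjective (the only case the switch road
meets). -/
def HLiftNineSurj : Prop :=
  ∀ (W : WeierstrassCurve ℚ) [W.IsElliptic] [NeZero (W.conductorNorm ℤ)]
    (ρ : ModPGaloisRep ℚ (ZMod 3) 2), W.IsTorsionGaloisRep 3 ρ →
    Function.Surjective ρ → ¬ 9 ∣ W.conductorNorm ℤ → BCDT.IsModular W

/-- The semistable-at-`5` lifting input of the landed `freyModularity_of_lifts`, verbatim. -/
def HLiftTwentyFive : Prop :=
  ∀ (W : WeierstrassCurve ℚ) [W.IsElliptic] [NeZero (W.conductorNorm ℤ)],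
    ¬ 25 ∣ W.conductorNorm ℤ →
    ∀ (ρ : ModPGaloisRep ℚ (ZMod 5) 2), W.IsTorsionGaloisRep 5 ρ →
    ρ.IsAbsIrreducibleOverSqrt 5 → ρ.IsModular → BCDT.IsModular W

/-- LANDED `Summit.ABC.ABC.Theorems.isIrreducible_freyCurve_five` (reshape 3), verbatim type. -/
def FreyFiveIrreducible : Prop :=
  ∀ a b : ℤ, IsCoprime a b → a * b * (a + b) ≠ 0 →
    ∀ ρ : ModPGaloisRep ℚ (ZMod 5) 2, (freyCurve a b).IsTorsionGaloisRep 5 ρ →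
      FramedRep.IsIrreducible ρ

/-- LANDED `Summit.ABC.ABC.Theorems.stub_absIrrSqrtFive` (S4b), verbatim type. -/
def AbsIrrSqrtFive : Prop :=
  ∀ (W : WeierstrassCurve ℚ) [W.IsElliptic], ¬ 25 ∣ W.conductorNorm ℤ →
    ∀ ρ : ModPGaloisRep ℚ (ZMod 5) 2, W.IsTorsionGaloisRep 5 ρ →
      FramedRep.IsIrreducible ρ → ρ.IsAbsIrreducibleOverSqrt 5

/-- LANDED `Summit.ABC.ABC.Theorems.stub_nineTransfer` (S6), verbatim type. -/
def NineTransfer : Prop :=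
  ∀ (W W' : WeierstrassCurve ℚ) [W.IsElliptic] [W'.IsElliptic] (ρ : ModPGaloisRep ℚ (ZMod 5) 2),
    W.IsTorsionGaloisRep 5 ρ → W'.IsTorsionGaloisRep 5 ρ →
    ¬ 9 ∣ W.conductorNorm ℤ → ¬ 9 ∣ W'.conductorNorm ℤ

/-- `25 ∤ N_{E_(a,b)}` (= the landed `Summit.ABC.ABC.Theorems.not_twentyFive_dvd_conductorNorm_freyCurve`
of `Theorems/DefiniteXiFreyModularitySketch.lean`, re-proved here because that module is not in this
file's import closure; same proof). -/
theorem not_twentyFive_dvd_conductorNorm_freyCurve {a b : ℤ} (hab : IsCoprime a b)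
    (h0 : a * b * (a + b) ≠ 0) : ¬ 25 ∣ (freyCurve a b).conductorNorm ℤ := by
  intro h25
  have hdvd := conductorNorm_freyCurve_dvd_holds a b hab h0
  have h25' : 25 ∣ 2 ^ 8 * (UniqueFactorizationMonoid.radical (a * b * (a + b))).natAbs :=
    h25.trans hdvd
  have hcop : Nat.Coprime 25 (2 ^ 8) := by norm_num
  have h25r : 25 ∣ (UniqueFactorizationMonoid.radical (a * b * (a + b))).natAbs :=
    hcop.dvd_of_dvd_mul_left h25'
  have hsq : Squarefree (UniqueFactorizationMonoid.radical (a * b * (a + b))).natAbs :=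
    Int.squarefree_natAbs.mpr UniqueFactorizationMonoid.squarefree_radical
  have h5 : IsUnit (5 : ℕ) := hsq 5 ((show (5 : ℕ) * 5 = 25 by norm_num) ▸ h25r)
  exact absurd (Nat.isUnit_iff.mp h5) (by norm_num)

/-- The surjective half is a WEAKENING of the registered stub. -/
theorem stubModThreeSurj_of_stubModThree (h : StubModThree) : StubModThreeSurj :=
  fun W _ ρ hρ hs ↦
    h W ρ hρ (isAbsIrreducibleOverSqrt_neg_three_of_surjective ρ hs).isAbsolutelyIrreducible

/-! ## §1  PLAN F″ on the landed module: `isModular_freyCurve_of_lifts` minus case A -/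

/-- **L1 — every Frey curve is modular along the SWITCH ROAD ONLY** (the landed
`Summit.ABC.ABC.Theorems.isModular_freyCurve_of_lifts` with case A deleted, hence `hlift9` needed only at
the auxiliary curve's SURJECTIVE `ρ̄₃`; the Frey inputs `isIrreducible_freyCurve_five`,
`stub_absIrrSqrtFive`, `stub_nineTransfer` are the hypotheses `h4a h4b h6` (variant b),
`not_nine_dvd_…` is the landed theorem by name).  BCDT 2001, proof of Thm. 2.2.1, tame case, run on
`ρ̄ = ρ̄_{E,5}`. -/
theorem isModular_freyCurve_of_lifts_surj (hlift9 : HLiftNineSurj) (hlift25 : HLiftTwentyFive)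
    (hsw : exists_isTorsionGaloisRep_five_and_surjective_three)
    (h4a : FreyFiveIrreducible) (h4b : AbsIrrSqrtFive) (h6 : NineTransfer)
    {a b : ℤ} (hab : IsCoprime a b) (h0 : a * b * (a + b) ≠ 0)
    [NeZero ((freyCurve a b).conductorNorm ℤ)] : BCDT.IsModular (freyCurve a b) := by
  haveI := isElliptic_freyCurve h0
  have h9 : ¬ 9 ∣ (freyCurve a b).conductorNorm ℤ :=
    Summit.ABC.ABC.Theorems.not_nine_dvd_conductorNorm_freyCurve hab h0
  have h25 : ¬ 25 ∣ (freyCurve a b).conductorNorm ℤ :=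
    not_twentyFive_dvd_conductorNorm_freyCurve hab h0
  obtain ⟨ρ, hρ⟩ := (freyCurve a b).exists_isTorsionGaloisRep 5
  have hirr : FramedRep.IsIrreducible ρ := h4a a b hab h0 ρ hρ
  have h5 : ρ.IsAbsIrreducibleOverSqrt 5 := h4b (freyCurve a b) h25 ρ hρ hirr
  have hdet := (freyCurve a b).det_eq_modPCyclotomicCharacter_of_isTorsionGaloisRep_holds 5 ρ hρ
  -- the `3`–`5` switch, for EVERY Frey curve (no case analysis on `E[3]`)
  obtain ⟨W', hW', hρ', ρ₃', hρ₃', hsurj⟩ := hsw ρ h5.isAbsolutelyIrreducible hdet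
  haveI := hW'
  haveI : NeZero (W'.conductorNorm ℤ) := ⟨(conductorNorm_pos_holds W').ne'⟩
  have h9' : ¬ 9 ∣ W'.conductorNorm ℤ := h6 (freyCurve a b) W' ρ hρ hρ' h9
  have hE' : BCDT.IsModular W' := hlift9 W' ρ₃' hρ₃' hsurj h9'
  have hρmod : ρ.IsModular := hE'.isModular_of_isTorsionGaloisRep'' hρ'
  exact hlift25 (freyCurve a b) h25 ρ hρ h5 hρmod

/-- **L1′ — `FreyModularity` from the surjective lifting input at `3`, the lifting input at `5` and the
switch** (through the landed `freyModularity_iff_forall_isModular_freyCurve`). -/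
theorem freyModularity_of_lifts_surj (hlift9 : HLiftNineSurj) (hlift25 : HLiftTwentyFive)
    (hsw : exists_isTorsionGaloisRep_five_and_surjective_three)
    (h4a : FreyFiveIrreducible) (h4b : AbsIrrSqrtFive) (h6 : NineTransfer) :
    Summit.ABC.ABC.Theses.DefiniteXi.FreyModularity :=
  Summit.ABC.ABC.Theorems.freyModularity_iff_forall_isModular_freyCurve.mpr
    fun _ _ hab h0 _ ↦ isModular_freyCurve_of_lifts_surj hlift9 hlift25 hsw h4a h4b h6 hab h0

/-! ## §2  The lifting inputs from the registered engine stubs -/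

/-- `HLiftNineSurj` from S1a^surj + S1b + S9 (surjective ⇒ absolutely irreducible over `ℚ(√-3)` is the
tree's `isAbsIrreducibleOverSqrt_neg_three_of_surjective`). -/
theorem hLiftNineSurj_of_stubs (hmod3 : StubModThreeSurj) (hlift3 : StubLiftThree)
    (h32 : StubThreeImpTwo) : HLiftNineSurj :=
  fun W _ _ ρ hρ hs h9 ↦
    haveI : Fact (Nat.Prime 3) := ⟨Nat.prime_three⟩
    h32 W 3 (hlift3 W ρ hρ (isAbsIrreducibleOverSqrt_neg_three_of_surjective ρ hs) h9 (hmod3 W ρ hρ hs))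

/-- `HLiftTwentyFive` from S2 + S9. -/
theorem hLiftTwentyFive_of_stubs (hlift5 : StubLiftFive) (h32 : StubThreeImpTwo) : HLiftTwentyFive :=
  fun W _ _ h25 ρ hρ hirr hmod ↦
    haveI : Fact (Nat.Prime 5) := ⟨by norm_num⟩
    h32 W 5 (hlift5 W ρ hρ hirr h25 hmod)

/-! ## §3  PLAN F″: the crux BY NAME from S1a^surj, S1b, S2, S9 and the SBT switch fact -/

/-- ★ `FreyModularity` from the surjective half of S1a, the registered S1b/S2/S9 and
`BCDT.exists_isTorsionGaloisRep_five_and_surjective_three` (+ the three landed Frey inputs, variant b). -/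
theorem FreyModularity_of_surjRoad (hmod3 : StubModThreeSurj) (hlift3 : StubLiftThree)
    (hlift5 : StubLiftFive) (h32 : StubThreeImpTwo)
    (hSBT : exists_isTorsionGaloisRep_five_and_surjective_three)
    (h4a : FreyFiveIrreducible) (h4b : AbsIrrSqrtFive) (h6 : NineTransfer) :
    Summit.ABC.ABC.Theses.DefiniteXi.FreyModularity :=
  freyModularity_of_lifts_surj (hLiftNineSurj_of_stubs hmod3 hlift3 h32)
    (hLiftTwentyFive_of_stubs hlift5 h32) hSBT h4a h4b h6

/-- The registered stub still feeds the surjective road. -/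
theorem FreyModularity_of_stubs' (hmod3 : StubModThree) (hlift3 : StubLiftThree)
    (hlift5 : StubLiftFive) (h32 : StubThreeImpTwo)
    (hSBT : exists_isTorsionGaloisRep_five_and_surjective_three)
    (h4a : FreyFiveIrreducible) (h4b : AbsIrrSqrtFive) (h6 : NineTransfer) :
    Summit.ABC.ABC.Theses.DefiniteXi.FreyModularity :=
  FreyModularity_of_surjRoad (stubModThreeSurj_of_stubModThree hmod3) hlift3 hlift5 h32 hSBT h4a h4b h6

/-! ## §4  PLAN T^surj — the surjective half from Tunnell 1981 + Gelbart Prop. 4.2 via O1, H1 -/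

/-- **O1** (statement; PROVED sorry-free in `STUB_IDEAS_stub_modThree_1_g6.lean` as `o1_of_helpers`):
a framed `ρ̄` onto `GL₂(𝔽₃)` has octahedral lift `Ψ ∘ ρ̄`. -/
def SigO1 : Prop :=
  ∀ ρ : ModPGaloisRep ℚ (ZMod 3) 2, Function.Surjective ρ →
    IsOctahedralType (modThreeLift ρ).toMonoidHom

/-- **H1** (statement; PROVED in `STUB_IDEAS_stub_modThree_1_g6.lean` l. 269: the tree's
`ModPGaloisRep.isModular_of_isAbsolutelyIrreducible_of_isOdd_of_langlands_tunnell` with its global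
hypothesis localised to `σ = Ψ ∘ ρ̄`). -/
def SigH1 : Prop :=
  ∀ ρ : ModPGaloisRep ℚ (ZMod 3) 2, langlands_tunnell (modThreeLift ρ) →
    FramedRep.IsAbsolutelyIrreducible ρ → FramedGaloisRep.IsOdd ρ → ρ.IsModular

/-- **H0** (PROVED): `ρ̄_{E,3}` is odd (`det ρ̄_{E,3} = χ̄₃`, Weil pairing). -/
theorem isOdd_of_isTorsionGaloisRep_three (W : WeierstrassCurve ℚ) [W.IsElliptic]
    (ρ : ModPGaloisRep ℚ (ZMod 3) 2) (hρ : W.IsTorsionGaloisRep 3 ρ) :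
    FramedGaloisRep.IsOdd ρ := by
  haveI : NeZero ((3 : ℕ) : ℚ) := ⟨by norm_num⟩
  intro φ c hc
  rw [W.det_eq_modPCyclotomicCharacter_of_isTorsionGaloisRep_holds 3 ρ hρ c]
  ext
  rw [modPCyclotomicCharacterZMod_eq_modNCyclotomicCharacter,
    modNCyclotomicCharacter_of_isComplexConjugation hc, Units.val_neg, Units.val_one]

/-- **H4** (PROVED): Langlands–Tunnell for ONE `σ` from the existence of `π(σ)` and Gelbart Prop. 4.2
(`exists_isNewform1_of_isPiOfArtinRep`); Prop. 4.1 is the tree THEOREM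
`frobSatakeCompatibleAt_of_isPiOfArtinRep_holds`. -/
theorem langlands_tunnell_of_exists_isPiOfArtinRep (hW1 : exists_isNewform1_of_isPiOfArtinRep)
    (σ : FramedArtinRep ℚ 2)
    (hπ : σ.toGaloisRep.IsIrreducible →
      ∃ (hcpt : isCompact_glFiniteIntegralLevel 2 ℚ) (π : CuspidalAutomorphicRepData 2 ℚ hcpt),
        IsPiOfArtinRep σ π.1) :
    langlands_tunnell σ := by
  intro hirr hodd _hsolv
  obtain ⟨hcpt, π, hπ⟩ := hπ hirr
  obtain ⟨N, hN, f, hf, -, hsat⟩ := hW1 hcpt σ π hirr hodd hπ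
  refine ⟨N, hN, f, hf, fun v hv => ?_⟩
  obtain ⟨α, hα, hpoly⟩ := hsat v hv
  obtain ⟨hur, hchar⟩ := frobSatakeCompatibleAt_of_isPiOfArtinRep_holds hcpt σ π hπ v α hα
  exact ⟨hur, hpoly ▸ hchar⟩

/-- ★ **`StubModThreeSurj` from O1, H1 and the TWO catalogued facts `strongArtin_of_isOctahedralType`
(Tunnell 1981) and `exists_isNewform1_of_isPiOfArtinRep` (Gelbart 1997, Prop. 4.2).** -/
theorem stubModThreeSurj_of_two_facts (hO1 : SigO1) (hH1 : SigH1)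
    (ho : strongArtin_of_isOctahedralType) (hW1 : exists_isNewform1_of_isPiOfArtinRep) :
    StubModThreeSurj := by
  intro W _ ρ hρ hs
  have habs : FramedRep.IsAbsolutelyIrreducible ρ :=
    (isAbsIrreducibleOverSqrt_neg_three_of_surjective ρ hs).isAbsolutelyIrreducible
  have hodd : FramedGaloisRep.IsOdd ρ := isOdd_of_isTorsionGaloisRep_three W ρ hρ
  refine hH1 ρ ?_ habs hodd
  exact langlands_tunnell_of_exists_isPiOfArtinRep hW1 (modThreeLift ρ) fun hirr' ↦
    ho (modThreeLift ρ) hirr' (hO1 ρ hs)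

/-- ★★ **The Frey crux from O1 + H1 + {Tunnell, Gelbart 4.2, SBT switch} + the registered S1b, S2, S9**
(sorry-free; every Frey-specific input is a landed theorem used by name). -/
theorem FreyModularity_of_two_facts (hO1 : SigO1) (hH1 : SigH1)
    (ho : strongArtin_of_isOctahedralType) (hW1 : exists_isNewform1_of_isPiOfArtinRep)
    (hSBT : exists_isTorsionGaloisRep_five_and_surjective_three)
    (hlift3 : StubLiftThree) (hlift5 : StubLiftFive) (h32 : StubThreeImpTwo)
    (h4a : FreyFiveIrreducible) (h4b : AbsIrrSqrtFive) (h6 : NineTransfer) :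
    Summit.ABC.ABC.Theses.DefiniteXi.FreyModularity :=
  FreyModularity_of_surjRoad (stubModThreeSurj_of_two_facts hO1 hH1 ho hW1) hlift3 hlift5 h32 hSBT
    h4a h4b h6

end Summit.ABC.ABC.Cruxes.FreyModularity.Sketch.StubModThreeIdeasK1G9b

end
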